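import Mathlib
import HarnessLib
import Literature.MathematicalPhysics.QuantumLattice.FermiRG.BGM2003Sectors

/-!
# Route `KLProgramme` — K3 engine (stmt-HubbardSuperconductivity-20437), stub (b) (ℓ)/(I2)–(I3), located item «ABS-UMK-COUNT»:
# the TWO CONSERVATION WINDOWS of a kept triple of legs in a chart (tangential: linear; normal: through the graph function)

Cell gate-hubbard-kl, seat p4 g15 (route HOME/prover-p4/UV-REMEASURE-COUNT.md §5, steps (1)–(3)).  A string of `L` momenta `k_i = p⃗_F(θ_i) + d_i` on BGM 2003's
Fermi curve (`p⃗_F = BGM2003.fermiPoint u`, `u(·,0)` `2π`-periodic) with sector-box displacements `|d_i·e⃗_t(θ⋆)|, |d_i·e⃗_r(θ⋆)| ≤ δ` and momentum sum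
`Σ k_i = R`, three distinguished legs `a, b, c` at angles `θ_x = θ⋆ + φ_x + 2πj_x` with `|φ_x| ≤ Φ` inside the chart window of part 9
(`f(U φ) = V φ`, `U φ = (p⃗_F(θ⋆+φ) − p⃗_F(θ⋆))·e⃗_t(θ⋆)`, `V φ = −(p⃗_F(θ⋆+φ) − p⃗_F(θ⋆))·e⃗_r(θ⋆)`): then with
`Q := R − Σ_{i ∉ {a,b,c}} p⃗_F(θ_i) − 3·p⃗_F(θ⋆)` (a vector depending only on the OTHER legs),

* **`tripleWindows_of_conservation`** — `|U φ_a + U φ_b + U φ_c − Q·e⃗_t(θ⋆)| ≤ L·δ` and `|f(U φ_a) + f(U φ_b) + f(U φ_c) + Q·e⃗_r(θ⋆)| ≤ L·δ`.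

These are exactly the two windows of the anchored triple count `ThinLevelSet.card_tripleWindow_le` (part 8) with `τ = Q·e⃗_t(θ⋆)`, `β = −Q·e⃗_r(θ⋆)`,
`δ_t = δ_n = Lδ`.  Everything is PROVED; no definitions, no named facts; linear algebra in `ℝ²`. [folklore]
-/

noncomputable section

open Real Set
open Literature.MathematicalPhysics.QuantumLattice Literature.MathematicalPhysics.QuantumLattice.FermiRG
open Literature.MathematicalPhysics.QuantumLattice.FermiRG.BGM2003

namespace Summit.HubbardSuperconductivity.HubbardSuperconductivity.Theorems.AbsUmklappCount

set_option linter.dupNamespace false -- summit = problem name (single-conjunct summit), D-0017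

/-! ## §1 Periodicity of the Fermi point -/

/-- `e⃗_r(θ + 2πj) = e⃗_r(θ)`. [folklore] -/
theorem dir_add_int_mul_two_pi (θ : ℝ) (j : ℤ) : dir (θ + j * (2 * π)) = dir θ := by
  ext i; fin_cases i
  · simp [Real.cos_add_int_mul_two_pi]
  · simp [Real.sin_add_int_mul_two_pi]

/-- `p⃗_F(θ + 2πj) = p⃗_F(θ)` for a `2π`-periodic Fermi radius. [cite: BenfattoGiulianiMastropietro2003, §7.1 (A1.1) p.26 (L21–24)] -/
theorem fermiPoint_add_int_mul_two_pi {u : ℝ → ℝ → ℝ} (hper : Function.Periodic (fun θ => u θ 0) (2 * π)) (θ : ℝ) (j : ℤ) :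
    fermiPoint u (θ + j * (2 * π)) = fermiPoint u θ := by
  have h1 : u (θ + j * (2 * π)) 0 = u θ 0 := (hper.int_mul j) θ
  simp only [fermiPoint, levelPoint]
  rw [h1, dir_add_int_mul_two_pi]

/-! ## §2 The two windows -/

/-- Sum over a three-element Finset. [folklore] -/
theorem sum_triple {L : ℕ} {M : Type*} [AddCommMonoid M] {a b c : Fin L} (hab : a ≠ b) (hac : a ≠ c) (hbc : b ≠ c) (g : Fin L → M) :
    ∑ x ∈ ({a, b, c} : Finset (Fin L)), g x = g a + g b + g c := by
  rw [Finset.sum_insert (by simp [hab, hac]), Finset.sum_insert (by simp [hbc]), Finset.sum_singleton, add_assoc]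

/-- **The two conservation windows of a kept triple.**  See the module docstring. [folklore] -/
theorem tripleWindows_of_conservation {u : ℝ → ℝ → ℝ} (hper : Function.Periodic (fun θ => u θ 0) (2 * π))
    {L : ℕ} (θ : Fin L → ℝ) (k d : Fin L → (Fin 2 → ℝ)) (R : Fin 2 → ℝ)
    (hk : ∀ i, k i = fermiPoint u (θ i) + d i) (hsum : ∑ i, k i = R)
    (θs : ℝ) {δ : ℝ} (hdt : ∀ i, |d i ⬝ᵥ tdir θs| ≤ δ) (hdn : ∀ i, |d i ⬝ᵥ dir θs| ≤ δ)
    {a b c : Fin L} (hab : a ≠ b) (hac : a ≠ c) (hbc : b ≠ c)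
    (φ : Fin L → ℝ) (j : Fin L → ℤ) (hθ : ∀ x ∈ ({a, b, c} : Finset (Fin L)), θ x = θs + φ x + j x * (2 * π))
    {f : ℝ → ℝ} {Φ : ℝ}
    (hval : ∀ ψ ∈ Icc (-Φ) Φ,
      f ((fermiPoint u (θs + ψ) - fermiPoint u θs) ⬝ᵥ tdir θs) = -((fermiPoint u (θs + ψ) - fermiPoint u θs) ⬝ᵥ dir θs))
    (hφ : ∀ x ∈ ({a, b, c} : Finset (Fin L)), φ x ∈ Icc (-Φ) Φ) :
    |(fermiPoint u (θs + φ a) - fermiPoint u θs) ⬝ᵥ tdir θs + (fermiPoint u (θs + φ b) - fermiPoint u θs) ⬝ᵥ tdir θs +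
        (fermiPoint u (θs + φ c) - fermiPoint u θs) ⬝ᵥ tdir θs -
        (R - ∑ i ∈ Finset.univ \ {a, b, c}, fermiPoint u (θ i) - (3 : ℝ) • fermiPoint u θs) ⬝ᵥ tdir θs| ≤ L * δ ∧
      |f ((fermiPoint u (θs + φ a) - fermiPoint u θs) ⬝ᵥ tdir θs) + f ((fermiPoint u (θs + φ b) - fermiPoint u θs) ⬝ᵥ tdir θs) +
        f ((fermiPoint u (θs + φ c) - fermiPoint u θs) ⬝ᵥ tdir θs) +
        (R - ∑ i ∈ Finset.univ \ {a, b, c}, fermiPoint u (θ i) - (3 : ℝ) • fermiPoint u θs) ⬝ᵥ dir θs| ≤ L * δ := by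
  set T : Finset (Fin L) := {a, b, c} with hT
  set Q := R - ∑ i ∈ Finset.univ \ T, fermiPoint u (θ i) - (3 : ℝ) • fermiPoint u θs with hQ
  have ha : a ∈ T := by simp [hT]
  have hb : b ∈ T := by simp [hT]
  have hc : c ∈ T := by simp [hT]
  -- the kept legs' Fermi points in the chart
  have hfp : ∀ x ∈ T, fermiPoint u (θ x) = fermiPoint u (θs + φ x) := by
    intro x hx
    rw [hθ x hx, fermiPoint_add_int_mul_two_pi hper]
  -- the vector identity `Σ_{x ∈ T} (p_F(θ⋆ + φ_x) − p_F(θ⋆)) = Q − Σ_i d_i`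
  have hsplit : ∑ i ∈ Finset.univ \ T, fermiPoint u (θ i) + ∑ x ∈ T, fermiPoint u (θ x) = ∑ i, fermiPoint u (θ i) :=
    Finset.sum_sdiff (Finset.subset_univ T)
  have hall : ∑ i, fermiPoint u (θ i) = R - ∑ i, d i := by
    have : ∑ i, k i = ∑ i, fermiPoint u (θ i) + ∑ i, d i := by
      rw [← Finset.sum_add_distrib]; exact Finset.sum_congr rfl fun i _ => hk i
    rw [hsum] at this
    rw [this]; abel
  have hvec : ∑ x ∈ T, (fermiPoint u (θs + φ x) - fermiPoint u θs) = Q - ∑ i, d i := by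
    have hcard : T.card = 3 := by
      rw [hT, Finset.card_insert_of_notMem (by simp [hab, hac]), Finset.card_insert_of_notMem (by simp [hbc]),
        Finset.card_singleton]
    have h1 : ∑ x ∈ T, fermiPoint u (θs + φ x) = ∑ x ∈ T, fermiPoint u (θ x) :=
      Finset.sum_congr rfl fun x hx => (hfp x hx).symm
    have h2 : ∑ x ∈ T, fermiPoint u (θ x) = (R - ∑ i, d i) - ∑ i ∈ Finset.univ \ T, fermiPoint u (θ i) := by
      rw [← hall, ← hsplit]; abel
    rw [Finset.sum_sub_distrib, Finset.sum_const, hcard, ← Nat.cast_smul_eq_nsmul ℝ, Nat.cast_ofNat, h1, h2, hQ]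
    abel
  -- dot products of the error sum
  have herr_t : |(∑ i, d i) ⬝ᵥ tdir θs| ≤ L * δ := by
    rw [sum_dotProduct]
    calc |∑ i, d i ⬝ᵥ tdir θs| ≤ ∑ i, |d i ⬝ᵥ tdir θs| := Finset.abs_sum_le_sum_abs _ _
      _ ≤ ∑ _i : Fin L, δ := Finset.sum_le_sum fun i _ => hdt i
      _ = L * δ := by rw [Finset.sum_const, nsmul_eq_mul, Finset.card_univ, Fintype.card_fin]
  have herr_n : |(∑ i, d i) ⬝ᵥ dir θs| ≤ L * δ := by
    rw [sum_dotProduct]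
    calc |∑ i, d i ⬝ᵥ dir θs| ≤ ∑ i, |d i ⬝ᵥ dir θs| := Finset.abs_sum_le_sum_abs _ _
      _ ≤ ∑ _i : Fin L, δ := Finset.sum_le_sum fun i _ => hdn i
      _ = L * δ := by rw [Finset.sum_const, nsmul_eq_mul, Finset.card_univ, Fintype.card_fin]
  -- scalar identities
  have htan : (fermiPoint u (θs + φ a) - fermiPoint u θs) ⬝ᵥ tdir θs + (fermiPoint u (θs + φ b) - fermiPoint u θs) ⬝ᵥ tdir θs +
      (fermiPoint u (θs + φ c) - fermiPoint u θs) ⬝ᵥ tdir θs = Q ⬝ᵥ tdir θs - (∑ i, d i) ⬝ᵥ tdir θs := by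
    rw [← sub_dotProduct, ← hvec, sum_dotProduct, hT, sum_triple hab hac hbc]
  have hnor : (fermiPoint u (θs + φ a) - fermiPoint u θs) ⬝ᵥ dir θs + (fermiPoint u (θs + φ b) - fermiPoint u θs) ⬝ᵥ dir θs +
      (fermiPoint u (θs + φ c) - fermiPoint u θs) ⬝ᵥ dir θs = Q ⬝ᵥ dir θs - (∑ i, d i) ⬝ᵥ dir θs := by
    rw [← sub_dotProduct, ← hvec, sum_dotProduct, hT, sum_triple hab hac hbc]
  -- the chart identity on the kept legs
  have hfa := hval (φ a) (hφ a ha)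
  have hfb := hval (φ b) (hφ b hb)
  have hfc := hval (φ c) (hφ c hc)
  constructor
  · rw [htan]
    have e : Q ⬝ᵥ tdir θs - (∑ i, d i) ⬝ᵥ tdir θs - Q ⬝ᵥ tdir θs = -((∑ i, d i) ⬝ᵥ tdir θs) := by ring
    rw [e, abs_neg]
    exact herr_t
  · rw [hfa, hfb, hfc]
    have e : -((fermiPoint u (θs + φ a) - fermiPoint u θs) ⬝ᵥ dir θs) + -((fermiPoint u (θs + φ b) - fermiPoint u θs) ⬝ᵥ dir θs) +
        -((fermiPoint u (θs + φ c) - fermiPoint u θs) ⬝ᵥ dir θs) + Q ⬝ᵥ dir θs =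
        -(((fermiPoint u (θs + φ a) - fermiPoint u θs) ⬝ᵥ dir θs + (fermiPoint u (θs + φ b) - fermiPoint u θs) ⬝ᵥ dir θs +
          (fermiPoint u (θs + φ c) - fermiPoint u θs) ⬝ᵥ dir θs) - Q ⬝ᵥ dir θs) := by ring
    rw [e, abs_neg, hnor]
    have e2 : Q ⬝ᵥ dir θs - (∑ i, d i) ⬝ᵥ dir θs - Q ⬝ᵥ dir θs = -((∑ i, d i) ⬝ᵥ dir θs) := by ring
    rw [e2, abs_neg]
    exact herr_n

end Summit.HubbardSuperconductivity.HubbardSuperconductivity.Theorems.AbsUmklappCount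

end
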